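import Mathlib
import Literature.NumberTheory.LFunctions.Zhang2022.GaussKernelContour
import Literature.NumberTheory.LFunctions.Zhang2022.SkeletonSetting
import HarnessLib

/-!
# The remainder of the Gaussian-kernel contour shift at Zhang's scales is `O(ε₁)`:
# the `exp{−c𝓛^{1/10}}`-arithmetic of (15.15), (16.10) done once

Topic `Literature/NumberTheory/LFunctions/Zhang2022` (Landau–Siegel audit tree; verdict-neutral).
Y. Zhang, *Discrete mean estimates and the Landau–Siegel zero*, arXiv:2211.02515v1 (2022)
[Zhang2022LandauSiegel] — **an unrefereed manuscript under adjudication**. Companion of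
`Zhang2022/GaussKernelContour.lean` (`GaussKernelContour.norm_lineIntegral_sub_residues_le`: the Landau
rectangle for the kernel `Y^{s+β}ω₁(s+β)/(s+β)` with the explicit remainder
`(1/2π)(E_tails + E_left + 2E_horiz)`). Here that remainder is evaluated at the manuscript's scales
(§2: `𝓛 = log D`, `P = e^{𝓛⁹}` (2.6), `T = e^{𝓛^{1.1}}`, `t₀ = 𝓛⁵¹⁹` (2.8); §4: `Λ = 𝓛³⁰`; the contour of
(15.15)/(16.10) [Z22 p.85 tex L4217–4222, p.92 tex L4550]: right line `Re s = 1`, left line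
`Re s = −c₁/𝓛` inside the zero-free region, height `H ≥ 𝓛²⁰`, `Y ≤ P·t₀` (`Y = P₄ = PT⁻²t₀`), and the
range condition «`P₄/d > T`», here `X·T ≤ Y` with `X = d`):

* `remainder_le_exp_neg_ell_tenth` (abstract `ℓ ≥ ℓ₀(c₁,k)`) and `remainder_le_eps1` (banked
  `Skeleton.ell/bigT/bigP/t0`, `D ≥ D₀(c₁,k)`) — if the three sup-bounds of the consumer's prefactor `Φ` are
  `M₀ ≤ B𝓛^k` (tails), `M₁ ≤ B𝓛^k·X^{c₁/𝓛}` (left line; the factor `X^{c₁/𝓛} = |d^{−s}|` there),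
  `M₂ ≤ B𝓛^k·Y^{c₁/𝓛}` (horizontal sides), with an arbitrary weight `B ≥ 0` (e.g.
  `C∏_{q∣dl}(1 + cq^{−9/10})`), then for `𝓛 ≥ 𝓛₀(c₁,k)` the remainder is `≤ B·exp{−(c₁/2)𝓛^{1/10}}` —
  the manuscript's `O(ε₁)`, `ε₁ = exp{−c𝓛^{1/10}}` (§7, tex L2128). The saving is the left line:
  `(X/Y)^{c₁/𝓛} ≤ T^{−c₁/𝓛} = exp{−c₁𝓛^{1/10}}` (`tails`/`horizontals` are `exp{−𝓛¹⁰/8}`-small by the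
  Gaussian).
* the three pieces separately: `tails_term_le`, `left_term_le`, `horiz_term_le`, and the two scale facts
  behind them, `gauss_height_le` (the Gaussian at height `H ≥ 𝓛²⁰` is `≤ e^{−𝓛¹⁰/8}`) and
  `rpow_div_le_exp_neg` (`(X/Y)^{c₁/𝓛} ≤ e^{−c₁𝓛^{1/10}}` when `X·T ≤ Y`).

Pure real analysis; nothing about the manuscript's Theorems 1–2 or about Landau–Siegel zeros is asserted,
and the manuscript's inputs (poles, zero-free region, the sizes `M₀, M₁, M₂`) remain the consumer's.

## References

* Y. Zhang, arXiv:2211.02515v1 (2022), §2 (2.6)–(2.10); §7 p.41 (`ε₁`); §15 (15.15) p.85; §16 (16.10)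
  p.92. [cite: Zhang2022LandauSiegel, §15 (15.15) p.85]
* H. L. Montgomery, R. C. Vaughan, *Multiplicative Number Theory I*, CUP 2007, §6.2 (Landau's contour and
  the choice of the abscissa `1 − c/log T`). [cite: MontgomeryVaughan2007, §6.2]
-/

noncomputable section

open Real

namespace Literature.NumberTheory.LFunctions.Zhang2022.GaussKernelContour

open Skeleton GaussWeight

/-! ### Elementary scale facts (`ℓ` plays `𝓛 = log D`) -/

/-- `x^n/n! ≤ e^x` turned into: `K·u^m ≤ exp(a·u)` as soon as `u ≥ K·(m+1)!/a^{m+1}` (`a > 0`,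
`u ≥ 0`). [folklore] -/
private theorem const_mul_pow_le_exp {K a u : ℝ} {m : ℕ} (ha : 0 < a) (hu : 0 ≤ u)
    (h : K * (m + 1).factorial ≤ a ^ (m + 1) * u) : K * u ^ m ≤ Real.exp (a * u) := by
  have h1 : (a * u) ^ (m + 1) / (m + 1).factorial ≤ Real.exp (a * u) :=
    Real.pow_div_factorial_le_exp (a * u) (by positivity) (m + 1)
  refine le_trans ?_ h1
  rw [le_div_iff₀ (by positivity), mul_pow, pow_succ a, pow_succ u]
  -- `K u^m (m+1)! ≤ a^m a u^m u`
  have hum : 0 ≤ u ^ m := by positivity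
  calc K * u ^ m * ((m + 1).factorial : ℝ) = (K * (m + 1).factorial) * u ^ m := by ring
    _ ≤ (a ^ (m + 1) * u) * u ^ m := mul_le_mul_of_nonneg_right h hum
    _ = a ^ m * a * (u ^ m * u) := by rw [pow_succ]; ring

/-- For `x ≥ 4`: `(x − 1)² ≥ x²/2`. [folklore] -/
private theorem sq_sub_one_ge {x : ℝ} (hx : 4 ≤ x) : x ^ 2 / 2 ≤ (x - 1) ^ 2 := by nlinarith

/-- **The Gaussian at the height of the contour**: for `ℓ ≥ 2`, `H ≥ ℓ²⁰` and `|b| ≤ 1`,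
`exp{−(H−|b|)²/(4ℓ³⁰)} ≤ exp{−ℓ¹⁰/8}`. [cite: Zhang2022LandauSiegel, §4 p.20 (the height `𝓛²⁰`)] -/
theorem gauss_height_le {ℓ H b : ℝ} (hℓ : 2 ≤ ℓ) (hH : ℓ ^ 20 ≤ H) (hb : |b| ≤ 1) :
    gauss (4 * ℓ ^ 30)⁻¹ (H - |b|) ≤ Real.exp (-(ℓ ^ 10 / 8)) := by
  rw [gauss]
  refine Real.exp_le_exp.mpr ?_
  have hℓ0 : 0 < ℓ := by linarith
  have h30 : 0 < ℓ ^ 30 := by positivity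
  have hx4 : (4 : ℝ) ≤ ℓ ^ 20 := by
    have : (2 : ℝ) ^ 20 ≤ ℓ ^ 20 := pow_le_pow_left₀ (by norm_num) hℓ 20
    nlinarith
  have hHb : ℓ ^ 20 - 1 ≤ H - |b| := by linarith
  have hHb0 : 0 ≤ ℓ ^ 20 - 1 := by linarith
  have hsq : (ℓ ^ 20) ^ 2 / 2 ≤ (H - |b|) ^ 2 :=
    (sq_sub_one_ge hx4).trans (pow_le_pow_left₀ hHb0 hHb 2)
  -- `(4ℓ³⁰)⁻¹ (H−|b|)² ≥ ℓ¹⁰/8`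
  have key : ℓ ^ 10 / 8 ≤ (4 * ℓ ^ 30)⁻¹ * (H - |b|) ^ 2 := by
    rw [inv_mul_eq_div, div_le_div_iff₀ (by norm_num) (by positivity)]
    have : (ℓ ^ 20) ^ 2 = ℓ ^ 30 * ℓ ^ 10 := by ring
    nlinarith
  linarith

/-- `ℓ^{1.1} = ℓ·ℓ^{1/10}` (`ℓ > 0`). [folklore] -/
private theorem rpow_eleven_tenths {ℓ : ℝ} (hℓ : 0 < ℓ) : ℓ ^ (1.1 : ℝ) = ℓ * ℓ ^ (1 / 10 : ℝ) := by
  rw [show (1.1 : ℝ) = 1 + 1 / 10 by norm_num, Real.rpow_add hℓ, Real.rpow_one]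

/-- **The saving of the left line**: for `0 < X`, `X·T ≤ Y` with `T = exp{ℓ^{1.1}}` and `ℓ > 0`,
`(X/Y)^{c₁/ℓ} ≤ exp{−c₁ℓ^{1/10}}` (`c₁ ≥ 0`). [cite: MontgomeryVaughan2007, §6.2] -/
theorem rpow_div_le_exp_neg {ℓ c₁ X Y : ℝ} (hℓ : 0 < ℓ) (hc₁ : 0 ≤ c₁) (hX : 0 < X)
    (hXY : X * Real.exp (ℓ ^ (1.1 : ℝ)) ≤ Y) :
    (X / Y) ^ (c₁ / ℓ) ≤ Real.exp (-(c₁ * ℓ ^ (1 / 10 : ℝ))) := by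
  have hT : 0 < Real.exp (ℓ ^ (1.1 : ℝ)) := Real.exp_pos _
  have hY : 0 < Y := lt_of_lt_of_le (by positivity) hXY
  have hq : X / Y ≤ (Real.exp (ℓ ^ (1.1 : ℝ)))⁻¹ := by
    rw [div_le_iff₀ hY, ← div_eq_inv_mul, le_div_iff₀ hT]
    exact hXY
  calc (X / Y) ^ (c₁ / ℓ) ≤ ((Real.exp (ℓ ^ (1.1 : ℝ)))⁻¹) ^ (c₁ / ℓ) :=
        Real.rpow_le_rpow (by positivity) hq (by positivity)
    _ = Real.exp (-(c₁ * ℓ ^ (1 / 10 : ℝ))) := by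
        rw [← Real.exp_neg, ← Real.exp_mul]
        congr 1
        rw [rpow_eleven_tenths hℓ]
        field_simp

/-- `Y ≤ e^{ℓ⁹}·ℓ⁵¹⁹ ≤ exp{2ℓ⁹}` for `ℓ ≥ 3` (`P·t₀ ≤ e^{2𝓛⁹}`). [cite: Zhang2022LandauSiegel, §2 (2.6)–(2.8)] -/
theorem exp_mul_pow_le_exp_two {ℓ : ℝ} (hℓ : 3 ≤ ℓ) :
    Real.exp (ℓ ^ 9) * ℓ ^ 519 ≤ Real.exp (2 * ℓ ^ 9) := by
  have hℓ0 : 0 < ℓ := by linarith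
  have h1 : ℓ ^ 519 ≤ Real.exp (519 * ℓ) := by
    have := Real.add_one_le_exp ℓ
    have h2 : ℓ ≤ Real.exp ℓ := by linarith
    calc ℓ ^ 519 ≤ (Real.exp ℓ) ^ 519 := pow_le_pow_left₀ hℓ0.le h2 519
      _ = Real.exp (519 * ℓ) := by rw [← Real.exp_nat_mul]; norm_num
  have h3 : 519 * ℓ ≤ ℓ ^ 9 := by
    have h8 : (3 : ℝ) ^ 8 ≤ ℓ ^ 8 := pow_le_pow_left₀ (by norm_num) hℓ 8
    have : ℓ ^ 9 = ℓ ^ 8 * ℓ := by ring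
    nlinarith
  calc Real.exp (ℓ ^ 9) * ℓ ^ 519 ≤ Real.exp (ℓ ^ 9) * Real.exp (519 * ℓ) :=
        mul_le_mul_of_nonneg_left h1 (Real.exp_nonneg _)
    _ = Real.exp (ℓ ^ 9 + 519 * ℓ) := (Real.exp_add _ _).symm
    _ ≤ Real.exp (2 * ℓ ^ 9) := Real.exp_le_exp.mpr (by linarith)

/-- `Y^{c₁/ℓ} ≤ exp{2c₁ℓ⁸}` when `1 ≤ Y ≤ exp{2ℓ⁹}` (`ℓ > 0`, `c₁ ≥ 0`). [folklore] -/
private theorem rpow_le_exp_of_le_exp {ℓ c₁ Y : ℝ} (hℓ : 0 < ℓ) (hc₁ : 0 ≤ c₁) (hY1 : 1 ≤ Y)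
    (hY : Y ≤ Real.exp (2 * ℓ ^ 9)) : Y ^ (c₁ / ℓ) ≤ Real.exp (2 * c₁ * ℓ ^ 8) := by
  have hY0 : 0 < Y := by linarith
  calc Y ^ (c₁ / ℓ) ≤ (Real.exp (2 * ℓ ^ 9)) ^ (c₁ / ℓ) :=
        Real.rpow_le_rpow hY0.le hY (by positivity)
    _ = Real.exp (2 * c₁ * ℓ ^ 8) := by
        rw [← Real.exp_mul]; congr 1; field_simp

/-- `√(4πℓ³⁰) ≤ 4ℓ¹⁵` (`ℓ ≥ 0`). [folklore] -/
private theorem sqrt_four_pi_pow_le {ℓ : ℝ} (hℓ : 0 ≤ ℓ) : Real.sqrt (4 * π * ℓ ^ 30) ≤ 4 * ℓ ^ 15 := by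
  have hπ : π ≤ 4 := Real.pi_le_four
  calc Real.sqrt (4 * π * ℓ ^ 30) ≤ Real.sqrt ((4 * ℓ ^ 15) ^ 2) :=
        Real.sqrt_le_sqrt (by nlinarith [pow_nonneg hℓ 30, show (4 * ℓ ^ 15) ^ 2 = 16 * ℓ ^ 30 by ring])
    _ = 4 * ℓ ^ 15 := Real.sqrt_sq (by positivity)

/-- `exp{x/(4ℓ³⁰)} ≤ 3` for `x ≤ 1 ≤ ℓ`. [folklore] -/
private theorem exp_div_four_pow_le {ℓ x : ℝ} (hℓ : 1 ≤ ℓ) (hx : x ≤ 1) : Real.exp (x / (4 * ℓ ^ 30)) ≤ 3 := by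
  have h30 : 1 ≤ ℓ ^ 30 := one_le_pow₀ hℓ
  have h1 : x / (4 * ℓ ^ 30) ≤ 1 := by
    rw [div_le_iff₀ (by positivity)]; linarith
  have he : Real.exp 1 ≤ 3 := by
    have := Real.exp_one_lt_d9; linarith
  exact (Real.exp_le_exp.mpr h1).trans he

/-- `ℓ^n ≤ exp(n·ℓ)` (`ℓ ≥ 0`). [folklore] -/
private theorem pow_le_exp_mul {ℓ : ℝ} (hℓ : 0 ≤ ℓ) (n : ℕ) : ℓ ^ n ≤ Real.exp (n * ℓ) := by
  have h2 : ℓ ≤ Real.exp ℓ := by have := Real.add_one_le_exp ℓ; linarith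
  calc ℓ ^ n ≤ (Real.exp ℓ) ^ n := pow_le_pow_left₀ hℓ h2 n
    _ = Real.exp (n * ℓ) := by rw [← Real.exp_nat_mul]

/-- **The Gaussian-killed pieces are `≤ 2e^{−ℓ}`**: for `n ≤ k + 15` and `ℓ ≥ 8(k+22)` (`ℓ ≥ 1`),
`12·ℓ^n·exp{2ℓ⁸ + 2ℓ⁹ − ℓ¹⁰/8} ≤ 2e^{−ℓ}`. [folklore] -/
private theorem twelve_pow_exp_le {ℓ : ℝ} {k n : ℕ} (hℓ1 : 1 ≤ ℓ) (hℓ : 8 * ((k : ℝ) + 22) ≤ ℓ) (hn : n ≤ k + 15) :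
    12 * ℓ ^ n * Real.exp (2 * ℓ ^ 8 + 2 * ℓ ^ 9 - ℓ ^ 10 / 8) ≤ 2 * Real.exp (-ℓ) := by
  have hℓ0 : 0 ≤ ℓ := by linarith
  have hpow := pow_le_exp_mul hℓ0 n
  have hn' : (n : ℝ) * ℓ ≤ (k + 15 : ℝ) * ℓ := by
    have : (n : ℝ) ≤ k + 15 := by exact_mod_cast hn
    exact mul_le_mul_of_nonneg_right this hℓ0
  -- powers of `ℓ ≥ 1` are monotone in the exponent
  have h89 : ℓ ^ 8 ≤ ℓ ^ 9 := pow_le_pow_right₀ hℓ1 (by norm_num)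
  have h19 : ℓ ≤ ℓ ^ 9 := by
    calc ℓ = ℓ ^ 1 := (pow_one ℓ).symm
      _ ≤ ℓ ^ 9 := pow_le_pow_right₀ hℓ1 (by norm_num)
  have h09 : (1 : ℝ) ≤ ℓ ^ 9 := one_le_pow₀ hℓ1
  have h10 : ℓ ^ 10 = ℓ ^ 9 * ℓ := by ring
  -- the exponent is `≤ −ℓ − 2`
  have hexp : (k + 15 : ℝ) * ℓ + (2 * ℓ ^ 8 + 2 * ℓ ^ 9 - ℓ ^ 10 / 8) ≤ -ℓ - 2 := by
    have hk0 : (0 : ℝ) ≤ k := Nat.cast_nonneg k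
    have h1 : (k + 15 : ℝ) * ℓ ≤ (k + 15 : ℝ) * ℓ ^ 9 := mul_le_mul_of_nonneg_left h19 (by linarith)
    have h2 : ((k : ℝ) + 22) * ℓ ^ 9 ≤ ℓ ^ 10 / 8 := by
      rw [h10, le_div_iff₀ (by norm_num : (0:ℝ) < 8)]
      have : 0 ≤ ℓ ^ 9 := by positivity
      nlinarith
    nlinarith
  have he2 : Real.exp (-2 : ℝ) ≤ 1 / 6 := by
    have h := Real.exp_one_gt_d9
    have h6 : (6 : ℝ) ≤ Real.exp 2 := by
      have : Real.exp 2 = Real.exp 1 * Real.exp 1 := by rw [← Real.exp_add]; norm_num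
      nlinarith
    rw [Real.exp_neg, one_div]
    exact inv_anti₀ (by norm_num) h6
  calc 12 * ℓ ^ n * Real.exp (2 * ℓ ^ 8 + 2 * ℓ ^ 9 - ℓ ^ 10 / 8)
      ≤ 12 * Real.exp ((k + 15 : ℝ) * ℓ) * Real.exp (2 * ℓ ^ 8 + 2 * ℓ ^ 9 - ℓ ^ 10 / 8) := by
        gcongr
        exact hpow.trans (Real.exp_le_exp.mpr hn')
    _ = 12 * Real.exp ((k + 15 : ℝ) * ℓ + (2 * ℓ ^ 8 + 2 * ℓ ^ 9 - ℓ ^ 10 / 8)) := by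
        rw [mul_assoc, ← Real.exp_add]
    _ ≤ 12 * Real.exp (-ℓ - 2) := by gcongr
    _ = 12 * Real.exp (-2) * Real.exp (-ℓ) := by
        rw [show -ℓ - 2 = -2 + -ℓ by ring, Real.exp_add]; ring
    _ ≤ 12 * (1 / 6) * Real.exp (-ℓ) := by gcongr
    _ = 2 * Real.exp (-ℓ) := by ring

/-- `e^{−ℓ} ≤ exp{−(c₁/2)ℓ^{1/10}}` for `ℓ ≥ 1`, `0 ≤ c₁ ≤ 1`. [folklore] -/
private theorem exp_neg_le_exp_neg_half_rpow {ℓ c₁ : ℝ} (hℓ : 1 ≤ ℓ) (hc₁ : 0 ≤ c₁) (hc₁1 : c₁ ≤ 1) :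
    Real.exp (-ℓ) ≤ Real.exp (-(c₁ / 2) * ℓ ^ (1 / 10 : ℝ)) := by
  refine Real.exp_le_exp.mpr ?_
  have h1 : ℓ ^ (1 / 10 : ℝ) ≤ ℓ := by
    have := Real.rpow_le_rpow_of_exponent_le hℓ (by norm_num : (1 / 10 : ℝ) ≤ 1)
    rwa [Real.rpow_one] at this
  have h0 : 0 ≤ ℓ ^ (1 / 10 : ℝ) := Real.rpow_nonneg (by linarith) _
  nlinarith

/-- **The left-line piece is absorbed**: `(12/c₁)·ℓ^{k+16}·exp{−c₁ℓ^{1/10}} ≤ 2exp{−(c₁/2)ℓ^{1/10}}` once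
`ℓ^{1/10} ≥ (6/c₁)·(m+1)!/(c₁/2)^{m+1}`, `m = 10(k+16)`. [folklore] -/
private theorem left_piece_absorb {ℓ c₁ : ℝ} {k : ℕ} (hℓ : 0 < ℓ) (hc₁ : 0 < c₁)
    (hu : 6 / c₁ * ((10 * (k + 16) + 1).factorial : ℝ) ≤
      (c₁ / 2) ^ (10 * (k + 16) + 1) * ℓ ^ (1 / 10 : ℝ)) :
    12 / c₁ * ℓ ^ (k + 16) * Real.exp (-(c₁ * ℓ ^ (1 / 10 : ℝ))) ≤
      2 * Real.exp (-(c₁ / 2) * ℓ ^ (1 / 10 : ℝ)) := by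
  set u : ℝ := ℓ ^ (1 / 10 : ℝ) with hu_def
  have hu0 : 0 ≤ u := Real.rpow_nonneg hℓ.le _
  have hpow : ℓ ^ (k + 16) = u ^ (10 * (k + 16)) := by
    rw [hu_def, ← Real.rpow_mul_natCast hℓ.le]
    rw [show (1 / 10 : ℝ) * ((10 * (k + 16) : ℕ) : ℝ) = ((k + 16 : ℕ) : ℝ) by push_cast; ring]
    rw [Real.rpow_natCast]
  have key : 6 / c₁ * u ^ (10 * (k + 16)) ≤ Real.exp (c₁ / 2 * u) :=
    const_mul_pow_le_exp (by positivity) hu0 hu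
  have hsplit : Real.exp (-(c₁ * u)) = Real.exp (-(c₁ / 2) * u) * Real.exp (-(c₁ / 2 * u)) := by
    rw [← Real.exp_add]; congr 1; ring
  rw [hpow, hsplit]
  have hE : 0 < Real.exp (-(c₁ / 2) * u) := Real.exp_pos _
  -- `(12/c₁) u^m e^{−(c₁/2)u} ≤ 2`
  have h2 : 12 / c₁ * u ^ (10 * (k + 16)) * Real.exp (-(c₁ / 2 * u)) ≤ 2 := by
    rw [Real.exp_neg, ← div_eq_mul_inv, div_le_iff₀ (Real.exp_pos _)]
    calc 12 / c₁ * u ^ (10 * (k + 16)) = 2 * (6 / c₁ * u ^ (10 * (k + 16))) := by ring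
      _ ≤ 2 * Real.exp (c₁ / 2 * u) := by gcongr
  calc 12 / c₁ * u ^ (10 * (k + 16)) * (Real.exp (-(c₁ / 2) * u) * Real.exp (-(c₁ / 2 * u)))
      = (12 / c₁ * u ^ (10 * (k + 16)) * Real.exp (-(c₁ / 2 * u))) * Real.exp (-(c₁ / 2) * u) := by
        ring
    _ ≤ 2 * Real.exp (-(c₁ / 2) * u) := mul_le_mul_of_nonneg_right h2 hE.le

/-! ### The three pieces of the remainder at Zhang's scales -/

section Terms

variable {ℓ c₁ B Y X H M₀ M₁ M₂ a : ℝ} {β : ℂ} {k : ℕ}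

/-- **Tails** (`Re s = 1`, `|t| ≥ H`): with `M₀ ≤ Bℓ^k`, `1 ≤ Y ≤ e^{ℓ⁹}ℓ⁵¹⁹`, `H ≥ ℓ²⁰`, `Re β = 0`,
`|Im β| ≤ 1`, `ℓ ≥ 3`: `E_tails ≤ B·12ℓ^{k+15}·exp{2ℓ⁹ − ℓ¹⁰/8}`.
[cite: Zhang2022LandauSiegel, §15 (15.15) p.85] -/
theorem tails_term_le (hℓ : 3 ≤ ℓ) (hβ : β.re = 0) (hb : |β.im| ≤ 1) (hB : 0 ≤ B)
    (hY1 : 1 ≤ Y) (hY : Y ≤ Real.exp (ℓ ^ 9) * ℓ ^ 519) (hH : ℓ ^ 20 ≤ H)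
    (hM₀ : M₀ ≤ B * ℓ ^ k) :
    2 * (M₀ * (Y ^ ((1 : ℝ) + β.re) * rexp (((1 : ℝ) + β.re) ^ 2 / (4 * ℓ ^ 30)) / |(1 : ℝ) + β.re|) *
        (gauss (4 * ℓ ^ 30)⁻¹ (H - |β.im|) * (Real.sqrt (4 * π * ℓ ^ 30) / 2))) ≤
      B * (12 * ℓ ^ (k + 15) * Real.exp (2 * ℓ ^ 8 + 2 * ℓ ^ 9 - ℓ ^ 10 / 8)) := by
  have hℓ0 : 0 < ℓ := by linarith
  have hℓ1 : 1 ≤ ℓ := by linarith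
  rw [hβ, add_zero, Real.rpow_one, one_pow, abs_one, div_one]
  have hE : rexp (1 / (4 * ℓ ^ 30)) ≤ 3 := exp_div_four_pow_le hℓ1 le_rfl
  have hG : gauss (4 * ℓ ^ 30)⁻¹ (H - |β.im|) ≤ Real.exp (-(ℓ ^ 10 / 8)) :=
    gauss_height_le (by linarith) hH hb
  have hS : Real.sqrt (4 * π * ℓ ^ 30) / 2 ≤ 2 * ℓ ^ 15 := by
    have := sqrt_four_pi_pow_le hℓ0.le; linarith
  have hYe : Y ≤ Real.exp (2 * ℓ ^ 9) := hY.trans (exp_mul_pow_le_exp_two hℓ)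
  have hP1 : 0 ≤ Y * rexp (1 / (4 * ℓ ^ 30)) := by positivity
  have hP2 : 0 ≤ gauss (4 * ℓ ^ 30)⁻¹ (H - |β.im|) * (Real.sqrt (4 * π * ℓ ^ 30) / 2) := by
    have := (gauss_pos (4 * ℓ ^ 30)⁻¹ (H - |β.im|)).le; positivity
  have hBk : 0 ≤ B * ℓ ^ k := by positivity
  have step1 : M₀ * (Y * rexp (1 / (4 * ℓ ^ 30))) ≤ (B * ℓ ^ k) * (Real.exp (2 * ℓ ^ 9) * 3) := by
    calc M₀ * (Y * rexp (1 / (4 * ℓ ^ 30))) ≤ (B * ℓ ^ k) * (Y * rexp (1 / (4 * ℓ ^ 30))) :=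
          mul_le_mul_of_nonneg_right hM₀ hP1
      _ ≤ (B * ℓ ^ k) * (Real.exp (2 * ℓ ^ 9) * 3) := by
          apply mul_le_mul_of_nonneg_left _ hBk
          exact mul_le_mul hYe hE (Real.exp_nonneg _) (Real.exp_nonneg _)
  have step2 : gauss (4 * ℓ ^ 30)⁻¹ (H - |β.im|) * (Real.sqrt (4 * π * ℓ ^ 30) / 2) ≤
      Real.exp (-(ℓ ^ 10 / 8)) * (2 * ℓ ^ 15) :=
    mul_le_mul hG hS (by positivity) (Real.exp_nonneg _)
  have step3 := mul_le_mul step1 step2 hP2 (by positivity)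
  calc 2 * (M₀ * (Y * rexp (1 / (4 * ℓ ^ 30))) *
        (gauss (4 * ℓ ^ 30)⁻¹ (H - |β.im|) * (Real.sqrt (4 * π * ℓ ^ 30) / 2)))
      ≤ 2 * ((B * ℓ ^ k) * (Real.exp (2 * ℓ ^ 9) * 3) *
        (Real.exp (-(ℓ ^ 10 / 8)) * (2 * ℓ ^ 15))) := by linarith
    _ = B * (12 * ℓ ^ (k + 15) * (Real.exp (2 * ℓ ^ 9) * Real.exp (-(ℓ ^ 10 / 8)))) := by ring
    _ ≤ B * (12 * ℓ ^ (k + 15) * Real.exp (2 * ℓ ^ 8 + 2 * ℓ ^ 9 - ℓ ^ 10 / 8)) := by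
        rw [← Real.exp_add]
        gcongr
        nlinarith [pow_nonneg hℓ0.le 8]

/-- **Left line** (`Re s = a = −c₁/ℓ`, `|t| ≤ H`): with `M₁ ≤ Bℓ^k·X^{c₁/ℓ}`, `0 < X`, `X·e^{ℓ^{1.1}} ≤ Y`,
`Re β = 0`, `0 < c₁ ≤ 1`, `ℓ ≥ 3`: `E_left ≤ B·(12/c₁)ℓ^{k+16}·exp{−c₁ℓ^{1/10}}` — the saving
`(X/Y)^{c₁/ℓ} ≤ T^{−c₁/ℓ}`. [cite: Zhang2022LandauSiegel, §15 (15.15) p.85] -/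
theorem left_term_le (hℓ : 3 ≤ ℓ) (hc₁ : 0 < c₁) (hc₁1 : c₁ ≤ 1) (hβ : β.re = 0) (hB : 0 ≤ B)
    (hX : 0 < X) (hXY : X * Real.exp (ℓ ^ (1.1 : ℝ)) ≤ Y) (ha : a = -(c₁ / ℓ))
    (hM₁ : M₁ ≤ B * ℓ ^ k * X ^ (c₁ / ℓ)) :
    M₁ * (Y ^ (a + β.re) * rexp ((a + β.re) ^ 2 / (4 * ℓ ^ 30)) / |a + β.re|) *
        Real.sqrt (4 * π * ℓ ^ 30) ≤
      B * (12 / c₁ * ℓ ^ (k + 16) * Real.exp (-(c₁ * ℓ ^ (1 / 10 : ℝ)))) := by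
  have hℓ0 : 0 < ℓ := by linarith
  have hℓ1 : 1 ≤ ℓ := by linarith
  have hY : 0 < Y := lt_of_lt_of_le (by positivity) hXY
  have hη : 0 < c₁ / ℓ := by positivity
  have hη1 : c₁ / ℓ ≤ 1 := by rw [div_le_one hℓ0]; linarith
  rw [hβ, add_zero, ha, abs_neg, abs_of_pos hη]
  -- the factors
  have hE : rexp ((-(c₁ / ℓ)) ^ 2 / (4 * ℓ ^ 30)) ≤ 3 :=
    exp_div_four_pow_le hℓ1 (by rw [neg_sq]; nlinarith)
  have hS : Real.sqrt (4 * π * ℓ ^ 30) ≤ 4 * ℓ ^ 15 := sqrt_four_pi_pow_le hℓ0.le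
  have hYa : Y ^ (-(c₁ / ℓ)) = (Y ^ (c₁ / ℓ))⁻¹ := Real.rpow_neg hY.le _
  have hYη : 0 < Y ^ (c₁ / ℓ) := Real.rpow_pos_of_pos hY _
  have hquot : X ^ (c₁ / ℓ) * (Y ^ (c₁ / ℓ))⁻¹ = (X / Y) ^ (c₁ / ℓ) := by
    rw [Real.div_rpow hX.le hY.le]
    exact (div_eq_mul_inv _ _).symm
  have hsave : (X / Y) ^ (c₁ / ℓ) ≤ Real.exp (-(c₁ * ℓ ^ (1 / 10 : ℝ))) :=
    rpow_div_le_exp_neg hℓ0 hc₁.le hX hXY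
  -- `M₁ · Y^{−η}`
  have hP : 0 ≤ (Y ^ (c₁ / ℓ))⁻¹ * rexp ((-(c₁ / ℓ)) ^ 2 / (4 * ℓ ^ 30)) / (c₁ / ℓ) := by positivity
  have step1 : M₁ * ((Y ^ (c₁ / ℓ))⁻¹ * rexp ((-(c₁ / ℓ)) ^ 2 / (4 * ℓ ^ 30)) / (c₁ / ℓ)) ≤
      (B * ℓ ^ k * X ^ (c₁ / ℓ)) * ((Y ^ (c₁ / ℓ))⁻¹ * 3 / (c₁ / ℓ)) := by
    calc M₁ * ((Y ^ (c₁ / ℓ))⁻¹ * rexp ((-(c₁ / ℓ)) ^ 2 / (4 * ℓ ^ 30)) / (c₁ / ℓ))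
        ≤ (B * ℓ ^ k * X ^ (c₁ / ℓ)) * ((Y ^ (c₁ / ℓ))⁻¹ * rexp ((-(c₁ / ℓ)) ^ 2 / (4 * ℓ ^ 30)) /
            (c₁ / ℓ)) := mul_le_mul_of_nonneg_right hM₁ hP
      _ ≤ (B * ℓ ^ k * X ^ (c₁ / ℓ)) * ((Y ^ (c₁ / ℓ))⁻¹ * 3 / (c₁ / ℓ)) := by
          apply mul_le_mul_of_nonneg_left _ (by positivity)
          gcongr
  have step2 := mul_le_mul step1 hS (Real.sqrt_nonneg _) (by positivity)
  rw [hYa]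
  refine step2.trans ?_
  -- regroup: `(X/Y)^η` appears
  have hre : B * ℓ ^ k * X ^ (c₁ / ℓ) * ((Y ^ (c₁ / ℓ))⁻¹ * 3 / (c₁ / ℓ)) * (4 * ℓ ^ 15) =
      B * (12 / c₁ * ℓ ^ (k + 16) * (X ^ (c₁ / ℓ) * (Y ^ (c₁ / ℓ))⁻¹)) := by
    field_simp
    ring
  rw [hre, hquot]
  gcongr

/-- **Horizontal sides** (`Im s = ±H`, `a ≤ Re s ≤ 1`): with `M₂ ≤ Bℓ^k·Y^{c₁/ℓ}`, `1 ≤ Y ≤ e^{ℓ⁹}ℓ⁵¹⁹`,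
`H ≥ ℓ²⁰`, `Re β = 0`, `|Im β| ≤ 1`, `a = −c₁/ℓ`, `0 < c₁ ≤ 1`, `ℓ ≥ 3`:
`2E_horiz ≤ B·12ℓ^k·exp{2ℓ⁸ + 2ℓ⁹ − ℓ¹⁰/8}`. [cite: Zhang2022LandauSiegel, §15 (15.15) p.85] -/
theorem horiz_term_le (hℓ : 3 ≤ ℓ) (hc₁ : 0 < c₁) (hc₁1 : c₁ ≤ 1) (hβ : β.re = 0) (hb : |β.im| ≤ 1)
    (hB : 0 ≤ B) (hY1 : 1 ≤ Y) (hY : Y ≤ Real.exp (ℓ ^ 9) * ℓ ^ 519) (hH : ℓ ^ 20 ≤ H)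
    (ha : a = -(c₁ / ℓ)) (hM₂ : M₂ ≤ B * ℓ ^ k * Y ^ (c₁ / ℓ)) :
    2 * (((1 : ℝ) - a) * (M₂ * (max (Y ^ (a + β.re)) (Y ^ ((1 : ℝ) + β.re)) *
        rexp (max ((a + β.re) ^ 2) (((1 : ℝ) + β.re) ^ 2) / (4 * ℓ ^ 30)) *
        gauss (4 * ℓ ^ 30)⁻¹ (H - |β.im|) / (H - |β.im|)))) ≤
      B * (12 * ℓ ^ k * Real.exp (2 * ℓ ^ 8 + 2 * ℓ ^ 9 - ℓ ^ 10 / 8)) := by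
  have hℓ0 : 0 < ℓ := by linarith
  have hℓ1 : 1 ≤ ℓ := by linarith
  have hY0 : 0 < Y := by linarith
  have hη : 0 < c₁ / ℓ := by positivity
  have hη1 : c₁ / ℓ ≤ 1 := by rw [div_le_one hℓ0]; linarith
  rw [hβ, add_zero, add_zero, Real.rpow_one, one_pow, ha]
  -- simplify the maxima
  have hmaxY : max (Y ^ (-(c₁ / ℓ))) Y ≤ Y := by
    refine max_le ?_ le_rfl
    have := Real.rpow_le_rpow_of_exponent_le hY1 (by linarith : -(c₁ / ℓ) ≤ 1)
    rwa [Real.rpow_one] at this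
  have hmaxY0 : 0 ≤ max (Y ^ (-(c₁ / ℓ))) Y := le_max_of_le_right hY0.le
  have hmaxsq : max ((-(c₁ / ℓ)) ^ 2) 1 = 1 := max_eq_right (by rw [neg_sq]; nlinarith)
  rw [hmaxsq]
  have hE : rexp (1 / (4 * ℓ ^ 30)) ≤ 3 := exp_div_four_pow_le hℓ1 le_rfl
  have hG : gauss (4 * ℓ ^ 30)⁻¹ (H - |β.im|) ≤ Real.exp (-(ℓ ^ 10 / 8)) :=
    gauss_height_le (by linarith) hH hb
  have hG0 := (gauss_pos (4 * ℓ ^ 30)⁻¹ (H - |β.im|)).le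
  -- `H − |Im β| ≥ 1`, so dividing by it only helps
  have hHb : 1 ≤ H - |β.im| := by
    have : (2 : ℝ) ^ 20 ≤ ℓ ^ 20 := pow_le_pow_left₀ (by norm_num) (by linarith : (2:ℝ) ≤ ℓ) 20
    nlinarith
  have hYe : Y ≤ Real.exp (2 * ℓ ^ 9) := hY.trans (exp_mul_pow_le_exp_two hℓ)
  have hYη : Y ^ (c₁ / ℓ) ≤ Real.exp (2 * ℓ ^ 8) := by
    have h := rpow_le_exp_of_le_exp hℓ0 hc₁.le hY1 hYe
    refine h.trans (Real.exp_le_exp.mpr ?_)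
    nlinarith [pow_nonneg hℓ0.le 8]
  -- the inner product
  have hP : 0 ≤ max (Y ^ (-(c₁ / ℓ))) Y * rexp (1 / (4 * ℓ ^ 30)) *
      gauss (4 * ℓ ^ 30)⁻¹ (H - |β.im|) / (H - |β.im|) := by positivity
  have hinner : max (Y ^ (-(c₁ / ℓ))) Y * rexp (1 / (4 * ℓ ^ 30)) *
      gauss (4 * ℓ ^ 30)⁻¹ (H - |β.im|) / (H - |β.im|) ≤
        Real.exp (2 * ℓ ^ 9) * 3 * Real.exp (-(ℓ ^ 10 / 8)) := by
    rw [div_le_iff₀ (by linarith)]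
    calc max (Y ^ (-(c₁ / ℓ))) Y * rexp (1 / (4 * ℓ ^ 30)) * gauss (4 * ℓ ^ 30)⁻¹ (H - |β.im|)
        ≤ Real.exp (2 * ℓ ^ 9) * 3 * Real.exp (-(ℓ ^ 10 / 8)) :=
          mul_le_mul (mul_le_mul (hmaxY.trans hYe) hE (Real.exp_nonneg _) (Real.exp_nonneg _))
            hG hG0 (by positivity)
      _ = Real.exp (2 * ℓ ^ 9) * 3 * Real.exp (-(ℓ ^ 10 / 8)) * 1 := (mul_one _).symm
      _ ≤ Real.exp (2 * ℓ ^ 9) * 3 * Real.exp (-(ℓ ^ 10 / 8)) * (H - |β.im|) := by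
          gcongr
  have step1 : M₂ * (max (Y ^ (-(c₁ / ℓ))) Y * rexp (1 / (4 * ℓ ^ 30)) *
      gauss (4 * ℓ ^ 30)⁻¹ (H - |β.im|) / (H - |β.im|)) ≤
        (B * ℓ ^ k * Real.exp (2 * ℓ ^ 8)) * (Real.exp (2 * ℓ ^ 9) * 3 * Real.exp (-(ℓ ^ 10 / 8))) := by
    calc M₂ * (max (Y ^ (-(c₁ / ℓ))) Y * rexp (1 / (4 * ℓ ^ 30)) *
          gauss (4 * ℓ ^ 30)⁻¹ (H - |β.im|) / (H - |β.im|))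
        ≤ (B * ℓ ^ k * Y ^ (c₁ / ℓ)) * (max (Y ^ (-(c₁ / ℓ))) Y * rexp (1 / (4 * ℓ ^ 30)) *
            gauss (4 * ℓ ^ 30)⁻¹ (H - |β.im|) / (H - |β.im|)) := mul_le_mul_of_nonneg_right hM₂ hP
      _ ≤ (B * ℓ ^ k * Real.exp (2 * ℓ ^ 8)) *
            (Real.exp (2 * ℓ ^ 9) * 3 * Real.exp (-(ℓ ^ 10 / 8))) :=
          mul_le_mul (by gcongr) hinner hP (by positivity)
  have h1a : 0 ≤ (1 : ℝ) - -(c₁ / ℓ) := by linarith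
  have h1a' : (1 : ℝ) - -(c₁ / ℓ) ≤ 2 := by linarith
  have hR : 0 ≤ (B * ℓ ^ k * Real.exp (2 * ℓ ^ 8)) *
      (Real.exp (2 * ℓ ^ 9) * 3 * Real.exp (-(ℓ ^ 10 / 8))) := by positivity
  calc 2 * (((1 : ℝ) - -(c₁ / ℓ)) * (M₂ * (max (Y ^ (-(c₁ / ℓ))) Y * rexp (1 / (4 * ℓ ^ 30)) *
        gauss (4 * ℓ ^ 30)⁻¹ (H - |β.im|) / (H - |β.im|))))
      ≤ 2 * (2 * ((B * ℓ ^ k * Real.exp (2 * ℓ ^ 8)) *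
          (Real.exp (2 * ℓ ^ 9) * 3 * Real.exp (-(ℓ ^ 10 / 8))))) := by
        have h1 := mul_le_mul_of_nonneg_left step1 h1a
        have h2 := mul_le_mul_of_nonneg_right h1a' hR
        linarith
    _ = B * (12 * ℓ ^ k * (Real.exp (2 * ℓ ^ 8) * Real.exp (2 * ℓ ^ 9) * Real.exp (-(ℓ ^ 10 / 8)))) := by
        ring
    _ = B * (12 * ℓ ^ k * Real.exp (2 * ℓ ^ 8 + 2 * ℓ ^ 9 - ℓ ^ 10 / 8)) := by
        rw [← Real.exp_add, ← Real.exp_add]; ring_nf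

end Terms

/-! ### The remainder is `O(ε₁)` -/

/-- **The remainder of the Gaussian-kernel contour shift at Zhang's scales is `O(exp{−(c₁/2)𝓛^{1/10}})`.**
Let `0 < c₁ ≤ 1`, `k ∈ ℕ`. There is `ℓ₀ = ℓ₀(c₁,k) ≥ 3` such that for every `ℓ ≥ ℓ₀` (`ℓ` plays
`𝓛 = log D`) and all data with `Λ = ℓ³⁰`, `σ₀ = 1`, `a = −c₁/ℓ`, `Re β = 0`, `|Im β| ≤ 1`,
`1 ≤ Y ≤ e^{ℓ⁹}ℓ⁵¹⁹` (`= P·t₀ ≥ P₄`), `0 < X`, `X·e^{ℓ^{1.1}} ≤ Y` (the range «`P₄/d > T`» with `X = d`),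
`H ≥ ℓ²⁰`, and piece bounds `M₀ ≤ Bℓ^k`, `M₁ ≤ Bℓ^k·X^{c₁/ℓ}`, `M₂ ≤ Bℓ^k·Y^{c₁/ℓ}` (`B ≥ 0` arbitrary),
the right-hand side of `norm_lineIntegral_sub_residues_le` is `≤ B·exp{−(c₁/2)ℓ^{1/10}}`. So the error
of (15.15)/(16.10) is `O(ε₁·B)` with `B` the consumer's weight (e.g. `C∏_{q∣dl}(1+cq^{−9/10})`).
[cite: Zhang2022LandauSiegel, §15 (15.15) p.85] [cite: MontgomeryVaughan2007, §6.2] -/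
theorem remainder_le_exp_neg_ell_tenth {c₁ : ℝ} (hc₁ : 0 < c₁) (hc₁1 : c₁ ≤ 1) (k : ℕ) :
    ∃ ℓ₀ : ℝ, 3 ≤ ℓ₀ ∧ ∀ ⦃ℓ : ℝ⦄, ℓ₀ ≤ ℓ →
      ∀ ⦃B Y X H M₀ M₁ M₂ Λ σ₀ a : ℝ⦄ ⦃β : ℂ⦄, 0 ≤ B → β.re = 0 → |β.im| ≤ 1 →
        1 ≤ Y → Y ≤ Real.exp (ℓ ^ 9) * ℓ ^ 519 → 0 < X → X * Real.exp (ℓ ^ (1.1 : ℝ)) ≤ Y →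
        ℓ ^ 20 ≤ H → Λ = ℓ ^ 30 → σ₀ = 1 → a = -(c₁ / ℓ) →
        M₀ ≤ B * ℓ ^ k → M₁ ≤ B * ℓ ^ k * X ^ (c₁ / ℓ) → M₂ ≤ B * ℓ ^ k * Y ^ (c₁ / ℓ) →
        1 / (2 * π) *
          (2 * (M₀ * (Y ^ (σ₀ + β.re) * rexp ((σ₀ + β.re) ^ 2 / (4 * Λ)) / |σ₀ + β.re|) *
              (gauss (4 * Λ)⁻¹ (H - |β.im|) * (Real.sqrt (4 * π * Λ) / 2))) +
            M₁ * (Y ^ (a + β.re) * rexp ((a + β.re) ^ 2 / (4 * Λ)) / |a + β.re|) *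
              Real.sqrt (4 * π * Λ) +
            2 * ((σ₀ - a) * (M₂ * (max (Y ^ (a + β.re)) (Y ^ (σ₀ + β.re)) *
              rexp (max ((a + β.re) ^ 2) ((σ₀ + β.re) ^ 2) / (4 * Λ)) *
              gauss (4 * Λ)⁻¹ (H - |β.im|) / (H - |β.im|))))) ≤
          B * Real.exp (-(c₁ / 2) * ℓ ^ (1 / 10 : ℝ)) := by
  set m : ℕ := 10 * (k + 16) with hm
  set u₀ : ℝ := 6 / c₁ * ((m + 1).factorial : ℝ) / (c₁ / 2) ^ (m + 1) with hu₀
  have hu₀0 : 0 ≤ u₀ := by positivity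
  refine ⟨max (max 3 (8 * ((k : ℝ) + 22))) (u₀ ^ 10),
    le_trans (le_max_left _ _) (le_max_left _ _), ?_⟩
  intro ℓ hℓ B Y X H M₀ M₁ M₂ Λ σ₀ a β hB hβ hb hY1 hY hX hXY hH hΛ hσ₀ ha hM₀ hM₁ hM₂
  have hℓ3 : 3 ≤ ℓ := le_trans (le_trans (le_max_left _ _) (le_max_left _ _)) hℓ
  have hℓk : 8 * ((k : ℝ) + 22) ≤ ℓ := le_trans (le_trans (le_max_right _ _) (le_max_left _ _)) hℓ
  have hℓu : u₀ ^ 10 ≤ ℓ := le_trans (le_max_right _ _) hℓ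
  have hℓ0 : 0 < ℓ := by linarith
  have hℓ1 : 1 ≤ ℓ := by linarith
  subst hΛ hσ₀ ha
  -- the three pieces
  have h1 := tails_term_le (k := k) hℓ3 hβ hb hB hY1 hY hH hM₀
  have h2 := left_term_le (k := k) hℓ3 hc₁ hc₁1 hβ hB hX hXY rfl hM₁
  have h3 := horiz_term_le (k := k) hℓ3 hc₁ hc₁1 hβ hb hB hY1 hY hH rfl hM₂
  -- absorption of the polynomial factors
  have hA : 12 * ℓ ^ (k + 15) * Real.exp (2 * ℓ ^ 8 + 2 * ℓ ^ 9 - ℓ ^ 10 / 8) ≤ 2 * Real.exp (-ℓ) :=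
    twelve_pow_exp_le hℓ1 hℓk le_rfl
  have hC : 12 * ℓ ^ k * Real.exp (2 * ℓ ^ 8 + 2 * ℓ ^ 9 - ℓ ^ 10 / 8) ≤ 2 * Real.exp (-ℓ) :=
    twelve_pow_exp_le hℓ1 hℓk (by omega)
  have hroot : u₀ ≤ ℓ ^ (1 / 10 : ℝ) := by
    have h := Real.rpow_le_rpow (by positivity : (0 : ℝ) ≤ u₀ ^ 10) hℓu
      (by norm_num : (0 : ℝ) ≤ 1 / 10)
    have hid : (u₀ ^ 10) ^ (1 / 10 : ℝ) = u₀ := by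
      rw [show (1 / 10 : ℝ) = ((10 : ℕ) : ℝ)⁻¹ by norm_num]
      exact Real.pow_rpow_inv_natCast hu₀0 (by norm_num)
    rwa [hid] at h
  have hu : 6 / c₁ * ((10 * (k + 16) + 1).factorial : ℝ) ≤
      (c₁ / 2) ^ (10 * (k + 16) + 1) * ℓ ^ (1 / 10 : ℝ) := by
    have hcpos : 0 < (c₁ / 2) ^ (m + 1) := by positivity
    have h' : 6 / c₁ * ((m + 1).factorial : ℝ) ≤ (c₁ / 2) ^ (m + 1) * ℓ ^ (1 / 10 : ℝ) := by
      rw [hu₀, div_le_iff₀ hcpos] at hroot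
      linarith
    simpa only [hm] using h'
  have hB2 : 12 / c₁ * ℓ ^ (k + 16) * Real.exp (-(c₁ * ℓ ^ (1 / 10 : ℝ))) ≤
      2 * Real.exp (-(c₁ / 2) * ℓ ^ (1 / 10 : ℝ)) := left_piece_absorb hℓ0 hc₁ hu
  have hE : Real.exp (-ℓ) ≤ Real.exp (-(c₁ / 2) * ℓ ^ (1 / 10 : ℝ)) :=
    exp_neg_le_exp_neg_half_rpow hℓ1 hc₁.le hc₁1
  set E := Real.exp (-(c₁ / 2) * ℓ ^ (1 / 10 : ℝ)) with hEdef
  have hE0 : 0 < E := Real.exp_pos _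
  -- each piece is `≤ 2·B·E`
  have g1 := h1.trans (mul_le_mul_of_nonneg_left (hA.trans (by linarith)) hB : B * _ ≤ B * (2 * E))
  have g2 := h2.trans (mul_le_mul_of_nonneg_left hB2 hB)
  have g3 := h3.trans (mul_le_mul_of_nonneg_left (hC.trans (by linarith)) hB : B * _ ≤ B * (2 * E))
  have hsum := add_le_add (add_le_add g1 g2) g3
  have hπ3 : (3 : ℝ) ≤ π := by have := Real.pi_gt_three; linarith
  have hcoef : 1 / (2 * π) * (B * (2 * E) + B * (2 * E) + B * (2 * E)) ≤ B * E := by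
    rw [show B * (2 * E) + B * (2 * E) + B * (2 * E) = 6 * (B * E) by ring, ← mul_assoc,
      show 1 / (2 * π) * 6 = 3 / π by field_simp; ring]
    have hBE : 0 ≤ B * E := by positivity
    calc 3 / π * (B * E) ≤ 1 * (B * E) :=
          mul_le_mul_of_nonneg_right (by rw [div_le_one Real.pi_pos]; exact hπ3) hBE
      _ = B * E := one_mul _
  exact (mul_le_mul_of_nonneg_left hsum (by positivity)).trans hcoef

/-- `M ≤ 𝓛 = log D` for all large `D`. [folklore] -/
private theorem exists_nat_le_ell (M : ℝ) : ∃ D₀ : ℕ, ∀ D : ℕ, D₀ ≤ D → M ≤ ell D := by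
  refine ⟨⌈Real.exp M⌉₊ + 1, fun D hD => ?_⟩
  have h1 : Real.exp M ≤ D := by
    have : (⌈Real.exp M⌉₊ : ℝ) + 1 ≤ D := by exact_mod_cast hD
    linarith [Nat.le_ceil (Real.exp M)]
  have hD0 : (0 : ℝ) < D := lt_of_lt_of_le (Real.exp_pos M) h1
  rw [ell, Real.le_log_iff_exp_le hD0]
  exact h1

/-- **The same at the banked parameters of the skeleton** (`𝓛 = Skeleton.ell D`, `T = Skeleton.bigT D`,
`P·t₀ = Skeleton.bigP D * Skeleton.t0 D ≥ P₄`): for all `D ≥ D₀(c₁,k)` and all data with `Λ = 𝓛³⁰`,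
`σ₀ = 1`, `a = −c₁/𝓛`, `Re β = 0`, `|Im β| ≤ 1`, `1 ≤ Y ≤ P·t₀`, `0 < X`, `X·T ≤ Y`, `H ≥ 𝓛²⁰`,
`M₀ ≤ B𝓛^k`, `M₁ ≤ B𝓛^k·X^{c₁/𝓛}`, `M₂ ≤ B𝓛^k·Y^{c₁/𝓛}`, the remainder of
`norm_lineIntegral_sub_residues_le` is `≤ B·exp{−(c₁/2)𝓛^{1/10}}` (`= B·ε₁`).
[cite: Zhang2022LandauSiegel, §15 (15.15) p.85] [cite: MontgomeryVaughan2007, §6.2] -/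
theorem remainder_le_eps1 {c₁ : ℝ} (hc₁ : 0 < c₁) (hc₁1 : c₁ ≤ 1) (k : ℕ) :
    ∃ D₀ : ℕ, ∀ ⦃D : ℕ⦄, D₀ ≤ D →
      ∀ ⦃B Y X H M₀ M₁ M₂ Λ σ₀ a : ℝ⦄ ⦃β : ℂ⦄, 0 ≤ B → β.re = 0 → |β.im| ≤ 1 →
        1 ≤ Y → Y ≤ bigP D * t0 D → 0 < X → X * bigT D ≤ Y →
        ell D ^ 20 ≤ H → Λ = ell D ^ 30 → σ₀ = 1 → a = -(c₁ / ell D) →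
        M₀ ≤ B * ell D ^ k → M₁ ≤ B * ell D ^ k * X ^ (c₁ / ell D) →
        M₂ ≤ B * ell D ^ k * Y ^ (c₁ / ell D) →
        1 / (2 * π) *
          (2 * (M₀ * (Y ^ (σ₀ + β.re) * rexp ((σ₀ + β.re) ^ 2 / (4 * Λ)) / |σ₀ + β.re|) *
              (gauss (4 * Λ)⁻¹ (H - |β.im|) * (Real.sqrt (4 * π * Λ) / 2))) +
            M₁ * (Y ^ (a + β.re) * rexp ((a + β.re) ^ 2 / (4 * Λ)) / |a + β.re|) *
              Real.sqrt (4 * π * Λ) +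
            2 * ((σ₀ - a) * (M₂ * (max (Y ^ (a + β.re)) (Y ^ (σ₀ + β.re)) *
              rexp (max ((a + β.re) ^ 2) ((σ₀ + β.re) ^ 2) / (4 * Λ)) *
              gauss (4 * Λ)⁻¹ (H - |β.im|) / (H - |β.im|))))) ≤
          B * Real.exp (-(c₁ / 2) * ell D ^ (1 / 10 : ℝ)) := by
  obtain ⟨ℓ₀, -, h⟩ := remainder_le_exp_neg_ell_tenth hc₁ hc₁1 k
  obtain ⟨D₀, hD₀⟩ := exists_nat_le_ell ℓ₀
  refine ⟨D₀, fun D hD B Y X H M₀ M₁ M₂ Λ σ₀ a β hB hβ hb hY1 hY hX hXY hH hΛ hσ₀ ha hM₀ hM₁ hM₂ => ?_⟩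
  exact h (hD₀ D hD) hB hβ hb hY1 hY hX hXY hH hΛ hσ₀ ha hM₀ hM₁ hM₂

/-! ### The remainder at a FIXED left abscissa (`Y = T`, no zero-free region): §15 p.87, §16 p.94

For the integrands `ζ(1+s)²L(1+s−βⱼ,χ)²E(1+s)·Tˢω₁(s)/s` (§15.u055, p.87) and
`ζ(1+s)²ζ(1+s−βⱼ)L(1+s,χ)L(1+s−βⱼ,χ)²E₂ⱼ(1+s)·Tˢω₁(s)/s` (§16.u041, p.94) the `L`-functions sit in the
NUMERATOR, so the left side of Landau's rectangle may be taken at a FIXED abscissa `Re s = −a₀`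
(`a₀ ∈ (0, 1/10)`, inside the half-plane of the Euler product `E`), and the kernel has `Y = T = e^{𝓛^{1.1}}`,
`β = 0`: the saving is `T^{−a₀} = exp{−a₀𝓛^{1.1}}` against sup-bounds of `Φ` that are at most `exp{κ𝓛}`
(polynomial in `D` and in the height). -/

/-- `12·ℓⁿ·exp{κℓ⁹ + 2ℓ⁸ + 2ℓ⁹ − ℓ¹⁰/8} ≤ 2e^{−ℓ²}` for `n ≤ k + 15`, `ℓ ≥ 8(k + κ + 20)`, `ℓ ≥ 1`, `κ ≥ 0`.
[folklore] -/
private theorem twelve_pow_exp_le_sq {ℓ κ : ℝ} {k n : ℕ} (hℓ1 : 1 ≤ ℓ) (hκ : 0 ≤ κ)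
    (hℓ : 8 * ((k : ℝ) + κ + 20) ≤ ℓ) (hn : n ≤ k + 15) :
    12 * ℓ ^ n * Real.exp (κ * ℓ ^ 9 + 2 * ℓ ^ 8 + 2 * ℓ ^ 9 - ℓ ^ 10 / 8) ≤ 2 * Real.exp (-ℓ ^ 2) := by
  have hℓ0 : 0 ≤ ℓ := by linarith
  have hpow := pow_le_exp_mul hℓ0 n
  have hn' : (n : ℝ) * ℓ ≤ (k + 15 : ℝ) * ℓ := by
    have : (n : ℝ) ≤ k + 15 := by exact_mod_cast hn
    exact mul_le_mul_of_nonneg_right this hℓ0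
  have h89 : ℓ ^ 8 ≤ ℓ ^ 9 := pow_le_pow_right₀ hℓ1 (by norm_num)
  have h19 : ℓ ≤ ℓ ^ 9 := by
    calc ℓ = ℓ ^ 1 := (pow_one ℓ).symm
      _ ≤ ℓ ^ 9 := pow_le_pow_right₀ hℓ1 (by norm_num)
  have h29 : ℓ ^ 2 ≤ ℓ ^ 9 := pow_le_pow_right₀ hℓ1 (by norm_num)
  have h09 : (1 : ℝ) ≤ ℓ ^ 9 := one_le_pow₀ hℓ1
  have h10 : ℓ ^ 10 = ℓ ^ 9 * ℓ := by ring
  have hk0 : (0 : ℝ) ≤ k := Nat.cast_nonneg k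
  have hexp : (k + 15 : ℝ) * ℓ + (κ * ℓ ^ 9 + 2 * ℓ ^ 8 + 2 * ℓ ^ 9 - ℓ ^ 10 / 8) ≤ -ℓ ^ 2 - 2 := by
    have h1 : (k + 15 : ℝ) * ℓ ≤ (k + 15 : ℝ) * ℓ ^ 9 := mul_le_mul_of_nonneg_left h19 (by linarith)
    have h2 : ((k : ℝ) + κ + 20) * ℓ ^ 9 ≤ ℓ ^ 10 / 8 := by
      rw [h10, le_div_iff₀ (by norm_num : (0:ℝ) < 8)]
      have : 0 ≤ ℓ ^ 9 := by positivity
      nlinarith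
    have h3 : κ * ℓ ^ 9 ≤ κ * ℓ ^ 9 := le_rfl
    nlinarith
  have he2 : Real.exp (-2 : ℝ) ≤ 1 / 6 := by
    have h := Real.exp_one_gt_d9
    have h6 : (6 : ℝ) ≤ Real.exp 2 := by
      have : Real.exp 2 = Real.exp 1 * Real.exp 1 := by rw [← Real.exp_add]; norm_num
      nlinarith
    rw [Real.exp_neg, one_div]
    exact inv_anti₀ (by norm_num) h6
  calc 12 * ℓ ^ n * Real.exp (κ * ℓ ^ 9 + 2 * ℓ ^ 8 + 2 * ℓ ^ 9 - ℓ ^ 10 / 8)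
      ≤ 12 * Real.exp ((k + 15 : ℝ) * ℓ) * Real.exp (κ * ℓ ^ 9 + 2 * ℓ ^ 8 + 2 * ℓ ^ 9 - ℓ ^ 10 / 8) := by
        gcongr
        exact hpow.trans (Real.exp_le_exp.mpr hn')
    _ = 12 * Real.exp ((k + 15 : ℝ) * ℓ + (κ * ℓ ^ 9 + 2 * ℓ ^ 8 + 2 * ℓ ^ 9 - ℓ ^ 10 / 8)) := by
        rw [mul_assoc, ← Real.exp_add]
    _ ≤ 12 * Real.exp (-ℓ ^ 2 - 2) := by gcongr
    _ = 12 * Real.exp (-2) * Real.exp (-ℓ ^ 2) := by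
        rw [show -ℓ ^ 2 - 2 = -2 + -ℓ ^ 2 by ring, Real.exp_add]; ring
    _ ≤ 12 * (1 / 6) * Real.exp (-ℓ ^ 2) := by gcongr
    _ = 2 * Real.exp (-ℓ ^ 2) := by ring

/-- `e^{−ℓ²} ≤ exp{−(a₀/2)ℓ^{1.1}}` for `ℓ ≥ 1`, `0 ≤ a₀ ≤ 1`. [folklore] -/
private theorem exp_neg_sq_le_exp_neg_half_rpow {ℓ a₀ : ℝ} (hℓ : 1 ≤ ℓ) (ha : 0 ≤ a₀) (ha1 : a₀ ≤ 1) :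
    Real.exp (-ℓ ^ 2) ≤ Real.exp (-(a₀ / 2) * ℓ ^ (1.1 : ℝ)) := by
  refine Real.exp_le_exp.mpr ?_
  have h1 : ℓ ^ (1.1 : ℝ) ≤ ℓ ^ 2 := by
    have := Real.rpow_le_rpow_of_exponent_le hℓ (by norm_num : (1.1 : ℝ) ≤ 2)
    rwa [show ((2 : ℝ)) = ((2 : ℕ) : ℝ) by norm_num, Real.rpow_natCast] at this
  have h0 : 0 ≤ ℓ ^ (1.1 : ℝ) := Real.rpow_nonneg (by linarith) _
  nlinarith

/-- `ℓ^{1.1} ≤ ℓ⁹` and hence `exp{ℓ^{1.1}} ≤ e^{ℓ⁹}ℓ⁵¹⁹` (`ℓ ≥ 1`): `T ≤ P·t₀`. [folklore] -/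
private theorem exp_rpow_le {ℓ : ℝ} (hℓ : 1 ≤ ℓ) :
    ℓ ^ (1.1 : ℝ) ≤ ℓ ^ 9 ∧ Real.exp (ℓ ^ (1.1 : ℝ)) ≤ Real.exp (ℓ ^ 9) * ℓ ^ 519 := by
  have h1 : ℓ ^ (1.1 : ℝ) ≤ ℓ ^ 9 := by
    have := Real.rpow_le_rpow_of_exponent_le hℓ (by norm_num : (1.1 : ℝ) ≤ 9)
    rwa [show ((9 : ℝ)) = ((9 : ℕ) : ℝ) by norm_num, Real.rpow_natCast] at this
  refine ⟨h1, ?_⟩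
  have h2 : (1 : ℝ) ≤ ℓ ^ 519 := one_le_pow₀ hℓ
  calc Real.exp (ℓ ^ (1.1 : ℝ)) ≤ Real.exp (ℓ ^ 9) := Real.exp_le_exp.mpr h1
    _ = Real.exp (ℓ ^ 9) * 1 := (mul_one _).symm
    _ ≤ Real.exp (ℓ ^ 9) * ℓ ^ 519 := by gcongr

/-- **The left piece at a fixed abscissa is absorbed**: for `ℓ ≥ 1` with
`ℓ^{1/10} ≥ (2/a₀)(6/a₀ + κ + 15)` (`0 < a₀ ≤ 1`, `κ ≥ 0`),
`(12/a₀)·ℓ¹⁵·exp{κℓ − a₀ℓ^{1.1}} ≤ 2·exp{−(a₀/2)ℓ^{1.1}}`. [folklore] -/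
private theorem left_fixed_absorb {ℓ a₀ κ : ℝ} (hℓ1 : 1 ≤ ℓ) (ha₀ : 0 < a₀) (hκ : 0 ≤ κ)
    (hu : 2 / a₀ * (6 / a₀ + κ + 15) ≤ ℓ ^ (1 / 10 : ℝ)) :
    12 / a₀ * ℓ ^ 15 * Real.exp (κ * ℓ - a₀ * ℓ ^ (1.1 : ℝ)) ≤
      2 * Real.exp (-(a₀ / 2) * ℓ ^ (1.1 : ℝ)) := by
  have hℓ0 : 0 < ℓ := by linarith
  set u : ℝ := ℓ ^ (1 / 10 : ℝ) with hudef
  have hu0 : 0 ≤ u := Real.rpow_nonneg hℓ0.le _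
  have h11 : ℓ ^ (1.1 : ℝ) = ℓ * u := rpow_eleven_tenths hℓ0
  -- `6/a₀ ≤ exp(6/a₀ · ℓ)` and `ℓ¹⁵ ≤ exp(15ℓ)`
  have h6 : 6 / a₀ ≤ Real.exp (6 / a₀ * ℓ) := by
    have h1 : 6 / a₀ ≤ 6 / a₀ * ℓ := by
      have := mul_le_mul_of_nonneg_left hℓ1 (by positivity : (0:ℝ) ≤ 6 / a₀)
      simpa using this
    have h2 := Real.add_one_le_exp (6 / a₀ * ℓ)
    linarith
  have h15 : ℓ ^ 15 ≤ Real.exp (15 * ℓ) := by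
    have := pow_le_exp_mul hℓ0.le 15; simpa using this
  -- the key exponent inequality `(6/a₀ + κ + 15)ℓ ≤ (a₀/2)ℓ^{1.1}`
  have hkey : (6 / a₀ + κ + 15) * ℓ ≤ (a₀ / 2) * ℓ ^ (1.1 : ℝ) := by
    rw [h11]
    have h1 : 6 / a₀ + κ + 15 ≤ (a₀ / 2) * u := by
      have := mul_le_mul_of_nonneg_left hu (by positivity : (0:ℝ) ≤ a₀ / 2)
      have h2 : a₀ / 2 * (2 / a₀ * (6 / a₀ + κ + 15)) = 6 / a₀ + κ + 15 := by
        field_simp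
      linarith [h2]
    have := mul_le_mul_of_nonneg_right h1 hℓ0.le
    linarith [this, show (a₀ / 2) * u * ℓ = (a₀ / 2) * (ℓ * u) by ring]
  have hsplit : Real.exp (κ * ℓ - a₀ * ℓ ^ (1.1 : ℝ)) =
      Real.exp (κ * ℓ - (a₀ / 2) * ℓ ^ (1.1 : ℝ)) * Real.exp (-(a₀ / 2) * ℓ ^ (1.1 : ℝ)) := by
    rw [← Real.exp_add]; congr 1; ring
  rw [hsplit, ← mul_assoc]
  refine mul_le_mul_of_nonneg_right ?_ (Real.exp_nonneg _)
  -- `(12/a₀)ℓ¹⁵ e^{κℓ − (a₀/2)ℓ^{1.1}} ≤ 2`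
  calc 12 / a₀ * ℓ ^ 15 * Real.exp (κ * ℓ - (a₀ / 2) * ℓ ^ (1.1 : ℝ))
      ≤ (2 * Real.exp (6 / a₀ * ℓ)) * Real.exp (15 * ℓ) * Real.exp (κ * ℓ - (a₀ / 2) * ℓ ^ (1.1 : ℝ)) := by
        gcongr
        · have : 12 / a₀ = 2 * (6 / a₀) := by ring
          rw [this]; gcongr
    _ = 2 * Real.exp ((6 / a₀ + κ + 15) * ℓ - (a₀ / 2) * ℓ ^ (1.1 : ℝ)) := by
        rw [mul_assoc, mul_assoc, ← Real.exp_add, ← Real.exp_add]; congr 1; congr 1; ring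
    _ ≤ 2 * Real.exp 0 := by gcongr; linarith
    _ = 2 := by rw [Real.exp_zero]; ring

section FixedAbscissa

variable {ℓ a₀ κ B Y H M₀ M₁ M₂ a : ℝ} {β : ℂ} {k : ℕ}

/-- **Left line at a fixed abscissa** (`Re s = −a₀`, `Y = e^{ℓ^{1.1}}`, `M₁ ≤ B·e^{κℓ}`, `Re β = 0`,
`0 < a₀ ≤ 1`, `ℓ ≥ 3`): `E_left ≤ B·(12/a₀)·ℓ¹⁵·exp{κℓ − a₀ℓ^{1.1}}`.
[cite: Zhang2022LandauSiegel, §15 p.87] -/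
theorem left_term_fixed_le (hℓ : 3 ≤ ℓ) (ha₀ : 0 < a₀) (ha₀1 : a₀ ≤ 1) (hβ : β.re = 0) (hB : 0 ≤ B)
    (hY : Y = Real.exp (ℓ ^ (1.1 : ℝ))) (ha : a = -a₀) (hM₁ : M₁ ≤ B * Real.exp (κ * ℓ)) :
    M₁ * (Y ^ (a + β.re) * rexp ((a + β.re) ^ 2 / (4 * ℓ ^ 30)) / |a + β.re|) *
        Real.sqrt (4 * π * ℓ ^ 30) ≤
      B * (12 / a₀ * ℓ ^ 15 * Real.exp (κ * ℓ - a₀ * ℓ ^ (1.1 : ℝ))) := by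
  have hℓ0 : 0 < ℓ := by linarith
  have hℓ1 : 1 ≤ ℓ := by linarith
  rw [hβ, add_zero, ha, abs_neg, abs_of_pos ha₀]
  have hE : rexp ((-a₀) ^ 2 / (4 * ℓ ^ 30)) ≤ 3 := exp_div_four_pow_le hℓ1 (by rw [neg_sq]; nlinarith)
  have hS : Real.sqrt (4 * π * ℓ ^ 30) ≤ 4 * ℓ ^ 15 := sqrt_four_pi_pow_le hℓ0.le
  have hYa : Y ^ (-a₀) = Real.exp (-(a₀ * ℓ ^ (1.1 : ℝ))) := by
    rw [hY, ← Real.exp_mul]; congr 1; ring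
  have hP : 0 ≤ Y ^ (-a₀) * rexp ((-a₀) ^ 2 / (4 * ℓ ^ 30)) / a₀ := by
    rw [hYa]; positivity
  have step1 : M₁ * (Y ^ (-a₀) * rexp ((-a₀) ^ 2 / (4 * ℓ ^ 30)) / a₀) ≤
      (B * Real.exp (κ * ℓ)) * (Real.exp (-(a₀ * ℓ ^ (1.1 : ℝ))) * 3 / a₀) := by
    calc M₁ * (Y ^ (-a₀) * rexp ((-a₀) ^ 2 / (4 * ℓ ^ 30)) / a₀)
        ≤ (B * Real.exp (κ * ℓ)) * (Y ^ (-a₀) * rexp ((-a₀) ^ 2 / (4 * ℓ ^ 30)) / a₀) :=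
          mul_le_mul_of_nonneg_right hM₁ hP
      _ ≤ (B * Real.exp (κ * ℓ)) * (Real.exp (-(a₀ * ℓ ^ (1.1 : ℝ))) * 3 / a₀) := by
          apply mul_le_mul_of_nonneg_left _ (by positivity)
          rw [hYa]; gcongr
  have step2 := mul_le_mul step1 hS (Real.sqrt_nonneg _) (by positivity)
  refine step2.trans (le_of_eq ?_)
  have : Real.exp (κ * ℓ) * Real.exp (-(a₀ * ℓ ^ (1.1 : ℝ))) = Real.exp (κ * ℓ - a₀ * ℓ ^ (1.1 : ℝ)) := by
    rw [← Real.exp_add, sub_eq_add_neg]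
  rw [← this]
  field_simp
  ring

/-- **Horizontal sides at a fixed abscissa** (`a = −a₀`, `Y = e^{ℓ^{1.1}}`, `H ≥ ℓ²⁰`, `|Im β| ≤ 1`,
`M₂ ≤ B·e^{κℓ}`): `2E_horiz ≤ B·12·exp{(κ+1)ℓ⁹ + 2ℓ⁸ + 2ℓ⁹ − ℓ¹⁰/8}`. [cite: Zhang2022LandauSiegel, §15 p.87] -/
theorem horiz_term_fixed_le (hℓ : 3 ≤ ℓ) (ha₀ : 0 < a₀) (ha₀1 : a₀ ≤ 1) (hκ : 0 ≤ κ) (hβ : β.re = 0)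
    (hb : |β.im| ≤ 1) (hB : 0 ≤ B) (hY : Y = Real.exp (ℓ ^ (1.1 : ℝ))) (hH : ℓ ^ 20 ≤ H)
    (ha : a = -a₀) (hM₂ : M₂ ≤ B * Real.exp (κ * ℓ)) :
    2 * (((1 : ℝ) - a) * (M₂ * (max (Y ^ (a + β.re)) (Y ^ ((1 : ℝ) + β.re)) *
        rexp (max ((a + β.re) ^ 2) (((1 : ℝ) + β.re) ^ 2) / (4 * ℓ ^ 30)) *
        gauss (4 * ℓ ^ 30)⁻¹ (H - |β.im|) / (H - |β.im|)))) ≤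
      B * (12 * Real.exp ((κ + 1) * ℓ ^ 9 + 2 * ℓ ^ 8 + 2 * ℓ ^ 9 - ℓ ^ 10 / 8)) := by
  have hℓ0 : 0 < ℓ := by linarith
  have hℓ1 : 1 ≤ ℓ := by linarith
  have hY1 : 1 ≤ Y := by rw [hY]; exact Real.one_le_exp (Real.rpow_nonneg hℓ0.le _)
  have hY0 : 0 < Y := by linarith
  rw [hβ, add_zero, add_zero, Real.rpow_one, one_pow, ha]
  have hmaxY : max (Y ^ (-a₀)) Y ≤ Y := by
    refine max_le ?_ le_rfl
    have := Real.rpow_le_rpow_of_exponent_le hY1 (by linarith : -a₀ ≤ 1)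
    rwa [Real.rpow_one] at this
  have hmaxsq : max ((-a₀) ^ 2) 1 = 1 := max_eq_right (by rw [neg_sq]; nlinarith)
  rw [hmaxsq]
  have hE : rexp (1 / (4 * ℓ ^ 30)) ≤ 3 := exp_div_four_pow_le hℓ1 le_rfl
  have hG : gauss (4 * ℓ ^ 30)⁻¹ (H - |β.im|) ≤ Real.exp (-(ℓ ^ 10 / 8)) :=
    gauss_height_le (by linarith) hH hb
  have hG0 := (gauss_pos (4 * ℓ ^ 30)⁻¹ (H - |β.im|)).le
  have hHb : 1 ≤ H - |β.im| := by
    have : (2 : ℝ) ^ 20 ≤ ℓ ^ 20 := pow_le_pow_left₀ (by norm_num) (by linarith : (2:ℝ) ≤ ℓ) 20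
    nlinarith
  -- `Y ≤ exp(ℓ⁹)`, `exp(κℓ) ≤ exp(κ ℓ⁹)`
  have h19 : ℓ ≤ ℓ ^ 9 := by
    calc ℓ = ℓ ^ 1 := (pow_one ℓ).symm
      _ ≤ ℓ ^ 9 := pow_le_pow_right₀ hℓ1 (by norm_num)
  have hYe : Y ≤ Real.exp (ℓ ^ 9) := by rw [hY]; exact Real.exp_le_exp.mpr (exp_rpow_le hℓ1).1
  have hκe : Real.exp (κ * ℓ) ≤ Real.exp (κ * ℓ ^ 9) :=
    Real.exp_le_exp.mpr (mul_le_mul_of_nonneg_left h19 hκ)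
  have hP : 0 ≤ max (Y ^ (-a₀)) Y * rexp (1 / (4 * ℓ ^ 30)) *
      gauss (4 * ℓ ^ 30)⁻¹ (H - |β.im|) / (H - |β.im|) := by
    have : 0 ≤ max (Y ^ (-a₀)) Y := le_max_of_le_right hY0.le
    positivity
  have hinner : max (Y ^ (-a₀)) Y * rexp (1 / (4 * ℓ ^ 30)) *
      gauss (4 * ℓ ^ 30)⁻¹ (H - |β.im|) / (H - |β.im|) ≤
        Real.exp (ℓ ^ 9) * 3 * Real.exp (-(ℓ ^ 10 / 8)) := by
    rw [div_le_iff₀ (by linarith)]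
    calc max (Y ^ (-a₀)) Y * rexp (1 / (4 * ℓ ^ 30)) * gauss (4 * ℓ ^ 30)⁻¹ (H - |β.im|)
        ≤ Real.exp (ℓ ^ 9) * 3 * Real.exp (-(ℓ ^ 10 / 8)) :=
          mul_le_mul (mul_le_mul (hmaxY.trans hYe) hE (Real.exp_nonneg _) (Real.exp_nonneg _))
            hG hG0 (by positivity)
      _ = Real.exp (ℓ ^ 9) * 3 * Real.exp (-(ℓ ^ 10 / 8)) * 1 := (mul_one _).symm
      _ ≤ Real.exp (ℓ ^ 9) * 3 * Real.exp (-(ℓ ^ 10 / 8)) * (H - |β.im|) := by gcongr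
  have step1 : M₂ * (max (Y ^ (-a₀)) Y * rexp (1 / (4 * ℓ ^ 30)) *
      gauss (4 * ℓ ^ 30)⁻¹ (H - |β.im|) / (H - |β.im|)) ≤
        (B * Real.exp (κ * ℓ ^ 9)) * (Real.exp (ℓ ^ 9) * 3 * Real.exp (-(ℓ ^ 10 / 8))) := by
    calc M₂ * (max (Y ^ (-a₀)) Y * rexp (1 / (4 * ℓ ^ 30)) *
          gauss (4 * ℓ ^ 30)⁻¹ (H - |β.im|) / (H - |β.im|))
        ≤ (B * Real.exp (κ * ℓ)) * (max (Y ^ (-a₀)) Y * rexp (1 / (4 * ℓ ^ 30)) *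
            gauss (4 * ℓ ^ 30)⁻¹ (H - |β.im|) / (H - |β.im|)) := mul_le_mul_of_nonneg_right hM₂ hP
      _ ≤ (B * Real.exp (κ * ℓ ^ 9)) * (Real.exp (ℓ ^ 9) * 3 * Real.exp (-(ℓ ^ 10 / 8))) :=
          mul_le_mul (by gcongr) hinner hP (by positivity)
  have h1a : 0 ≤ (1 : ℝ) - -a₀ := by linarith
  have h1a' : (1 : ℝ) - -a₀ ≤ 2 := by linarith
  have hR : 0 ≤ (B * Real.exp (κ * ℓ ^ 9)) * (Real.exp (ℓ ^ 9) * 3 * Real.exp (-(ℓ ^ 10 / 8))) := by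
    positivity
  have hexp8 : 0 ≤ 2 * ℓ ^ 8 := by positivity
  calc 2 * (((1 : ℝ) - -a₀) * (M₂ * (max (Y ^ (-a₀)) Y * rexp (1 / (4 * ℓ ^ 30)) *
        gauss (4 * ℓ ^ 30)⁻¹ (H - |β.im|) / (H - |β.im|))))
      ≤ 2 * (2 * ((B * Real.exp (κ * ℓ ^ 9)) * (Real.exp (ℓ ^ 9) * 3 * Real.exp (-(ℓ ^ 10 / 8))))) := by
        have h1 := mul_le_mul_of_nonneg_left step1 h1a
        have h2 := mul_le_mul_of_nonneg_right h1a' hR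
        linarith
    _ = B * (12 * Real.exp (κ * ℓ ^ 9 + ℓ ^ 9 + -(ℓ ^ 10 / 8))) := by
        rw [Real.exp_add, Real.exp_add]; ring
    _ ≤ B * (12 * Real.exp ((κ + 1) * ℓ ^ 9 + 2 * ℓ ^ 8 + 2 * ℓ ^ 9 - ℓ ^ 10 / 8)) := by
        gcongr
        nlinarith [pow_nonneg hℓ0.le 8, pow_nonneg hℓ0.le 9]

end FixedAbscissa

/-- **The remainder at a fixed left abscissa is `O(exp{−(a₀/2)𝓛^{1.1}})`.** Let `0 < a₀ ≤ 1`, `κ ≥ 0`,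
`k ∈ ℕ`. There is `ℓ₀ = ℓ₀(a₀,κ,k) ≥ 3` such that for every `ℓ ≥ ℓ₀` (`ℓ = 𝓛 = log D`) and all data with
`Λ = ℓ³⁰`, `σ₀ = 1`, `a = −a₀`, `Y = e^{ℓ^{1.1}}` (`= T`), `Re β = 0`, `|Im β| ≤ 1`, `H ≥ ℓ²⁰`, and piece
bounds `M₀ ≤ Bℓ^k` (tails), `M₁ ≤ B·e^{κℓ}` (left line), `M₂ ≤ B·e^{κℓ}` (horizontals) — `B ≥ 0` arbitrary,
`e^{κℓ} = D^κ` covering the polynomial growth of `ζ`, `L(·,χ)` left of `σ = 1` and of a `C·exp(2𝓛^{1/10})`-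
bounded Euler product (`Lemma153Rp`, `Lemma162Rp`) — the right-hand side of
`norm_lineIntegral_sub_residues_le` is `≤ B·exp{−(a₀/2)ℓ^{1.1}}`. This is the `O(α₁)`/`O(𝓛⁻⁴)`-step
«the contour is moved as in the proof of Lemma 8.4» of §15 p.87 (tex L4359) and §16 p.94 (tex L4662) for
the kernel `Tˢω₁(s)/s`, with room to spare. [cite: Zhang2022LandauSiegel, §15 p.87]
[cite: MontgomeryVaughan2007, §6.2] -/
theorem remainder_le_of_fixed_abscissa {a₀ κ : ℝ} (ha₀ : 0 < a₀) (ha₀1 : a₀ ≤ 1) (hκ : 0 ≤ κ) (k : ℕ) :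
    ∃ ℓ₀ : ℝ, 3 ≤ ℓ₀ ∧ ∀ ⦃ℓ : ℝ⦄, ℓ₀ ≤ ℓ →
      ∀ ⦃B Y H M₀ M₁ M₂ Λ σ₀ a : ℝ⦄ ⦃β : ℂ⦄, 0 ≤ B → β.re = 0 → |β.im| ≤ 1 →
        Y = Real.exp (ℓ ^ (1.1 : ℝ)) → ℓ ^ 20 ≤ H → Λ = ℓ ^ 30 → σ₀ = 1 → a = -a₀ →
        M₀ ≤ B * ℓ ^ k → M₁ ≤ B * Real.exp (κ * ℓ) → M₂ ≤ B * Real.exp (κ * ℓ) →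
        1 / (2 * π) *
          (2 * (M₀ * (Y ^ (σ₀ + β.re) * rexp ((σ₀ + β.re) ^ 2 / (4 * Λ)) / |σ₀ + β.re|) *
              (gauss (4 * Λ)⁻¹ (H - |β.im|) * (Real.sqrt (4 * π * Λ) / 2))) +
            M₁ * (Y ^ (a + β.re) * rexp ((a + β.re) ^ 2 / (4 * Λ)) / |a + β.re|) *
              Real.sqrt (4 * π * Λ) +
            2 * ((σ₀ - a) * (M₂ * (max (Y ^ (a + β.re)) (Y ^ (σ₀ + β.re)) *
              rexp (max ((a + β.re) ^ 2) ((σ₀ + β.re) ^ 2) / (4 * Λ)) *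
              gauss (4 * Λ)⁻¹ (H - |β.im|) / (H - |β.im|))))) ≤
          B * Real.exp (-(a₀ / 2) * ℓ ^ (1.1 : ℝ)) := by
  set u₀ : ℝ := 2 / a₀ * (6 / a₀ + κ + 15) with hu₀
  have hu₀0 : 0 ≤ u₀ := by positivity
  refine ⟨max (max 3 (8 * ((k : ℝ) + (κ + 1) + 20))) (u₀ ^ 10),
    le_trans (le_max_left _ _) (le_max_left _ _), ?_⟩
  intro ℓ hℓ B Y H M₀ M₁ M₂ Λ σ₀ a β hB hβ hb hY hH hΛ hσ₀ ha hM₀ hM₁ hM₂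
  have hℓ3 : 3 ≤ ℓ := le_trans (le_trans (le_max_left _ _) (le_max_left _ _)) hℓ
  have hℓk : 8 * ((k : ℝ) + (κ + 1) + 20) ≤ ℓ :=
    le_trans (le_trans (le_max_right _ _) (le_max_left _ _)) hℓ
  have hℓu : u₀ ^ 10 ≤ ℓ := le_trans (le_max_right _ _) hℓ
  have hℓ0 : 0 < ℓ := by linarith
  have hℓ1 : 1 ≤ ℓ := by linarith
  subst hΛ hσ₀ ha
  have hY1 : 1 ≤ Y := by rw [hY]; exact Real.one_le_exp (Real.rpow_nonneg hℓ0.le _)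
  have hYP : Y ≤ Real.exp (ℓ ^ 9) * ℓ ^ 519 := by rw [hY]; exact (exp_rpow_le hℓ1).2
  -- the three pieces
  have h1 := tails_term_le (k := k) hℓ3 hβ hb hB hY1 hYP hH hM₀
  have h2 := left_term_fixed_le (κ := κ) hℓ3 ha₀ ha₀1 hβ hB hY rfl hM₁
  have h3 := horiz_term_fixed_le hℓ3 ha₀ ha₀1 hκ hβ hb hB hY hH rfl hM₂
  -- absorption
  have hk0 : 8 * ((k : ℝ) + 0 + 20) ≤ ℓ := by linarith
  have hA : 12 * ℓ ^ (k + 15) * Real.exp (2 * ℓ ^ 8 + 2 * ℓ ^ 9 - ℓ ^ 10 / 8) ≤ 2 * Real.exp (-ℓ ^ 2) := by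
    have h := twelve_pow_exp_le_sq (κ := 0) (n := k + 15) hℓ1 le_rfl hk0 le_rfl
    simpa only [zero_mul, zero_add] using h
  have hC : 12 * Real.exp ((κ + 1) * ℓ ^ 9 + 2 * ℓ ^ 8 + 2 * ℓ ^ 9 - ℓ ^ 10 / 8) ≤
      2 * Real.exp (-ℓ ^ 2) := by
    have h := twelve_pow_exp_le_sq (κ := κ + 1) (n := 0) hℓ1 (by linarith) hℓk (by omega)
    simpa only [pow_zero, mul_one] using h
  have hroot : u₀ ≤ ℓ ^ (1 / 10 : ℝ) := by
    have h := Real.rpow_le_rpow (by positivity : (0 : ℝ) ≤ u₀ ^ 10) hℓu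
      (by norm_num : (0 : ℝ) ≤ 1 / 10)
    have hid : (u₀ ^ 10) ^ (1 / 10 : ℝ) = u₀ := by
      rw [show (1 / 10 : ℝ) = ((10 : ℕ) : ℝ)⁻¹ by norm_num]
      exact Real.pow_rpow_inv_natCast hu₀0 (by norm_num)
    rwa [hid] at h
  have hB2 := left_fixed_absorb (κ := κ) hℓ1 ha₀ hκ (by rw [hu₀] at hroot; exact hroot)
  have hE := exp_neg_sq_le_exp_neg_half_rpow hℓ1 ha₀.le ha₀1
  set E := Real.exp (-(a₀ / 2) * ℓ ^ (1.1 : ℝ)) with hEdef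
  have hE0 : 0 < E := Real.exp_pos _
  have g1 := h1.trans (mul_le_mul_of_nonneg_left (hA.trans (by linarith)) hB : B * _ ≤ B * (2 * E))
  have g2 := h2.trans (mul_le_mul_of_nonneg_left hB2 hB)
  have g3 := h3.trans (mul_le_mul_of_nonneg_left (hC.trans (by linarith)) hB : B * _ ≤ B * (2 * E))
  have hsum := add_le_add (add_le_add g1 g2) g3
  have hπ3 : (3 : ℝ) ≤ π := by have := Real.pi_gt_three; linarith
  have hcoef : 1 / (2 * π) * (B * (2 * E) + B * (2 * E) + B * (2 * E)) ≤ B * E := by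
    rw [show B * (2 * E) + B * (2 * E) + B * (2 * E) = 6 * (B * E) by ring, ← mul_assoc,
      show 1 / (2 * π) * 6 = 3 / π by field_simp; ring]
    have hBE : 0 ≤ B * E := by positivity
    calc 3 / π * (B * E) ≤ 1 * (B * E) :=
          mul_le_mul_of_nonneg_right (by rw [div_le_one Real.pi_pos]; exact hπ3) hBE
      _ = B * E := one_mul _
  exact (mul_le_mul_of_nonneg_left hsum (by positivity)).trans hcoef

end Literature.NumberTheory.LFunctions.Zhang2022.GaussKernelContour
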